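import Summits.ABC.IUTFork.Joshi.PrototypeJointModel
import Summits.ABC.IUTFork.Joshi.AdelicAnsatzLocalSupplyScaling
import HarnessLib

/-!
# The joint [J-IIp] model, part 2: abc-iut-E-t7's four inputs at its glued adelic curve datum, and the packaged census line
# «`EtaPtTeich` ∧ bijective `ϕ` ∧ E-t7's inputs — jointly satisfiable over E-t3's signature»

Test-side support file of the abc-iut cell, block E «type Joshi's construction, test vs S» (rung LADDER-ABC:A2.E; seat
abc-iut-E-t57, gen 2, the [J-IIp] MODEL / NV seat of plan/E/ASSIGNMENTS.md §2d). Sequel of `Joshi/PrototypeJointModel.lean` (part 1: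
the model `JointModel.prototypeDatum p` — points `Q̄_p/∼` modulo `p`-power roots of unity, bijective point-Frobenius, Hilbert-hotel
Teichmüller field — with `JointModel.etaPtTeich`, `JointModel.frobY_bijective`, `JointModel.exists_pth_root`), gluing it to E-t7's
[J-III] §4.1–4.2 signature `AdelicCurveDatum` (`Joshi/AdelicAnsatz.lean`) through this seat's certificate `PrototypeFamily` /
`PrototypeSupply` (`Joshi/AdelicAnsatzLocalSupply.lean`, p432358) exactly as `Joshi/AdelicAnsatzExponentInstance.lean` (p435471) did
for the exponent model. Everything BY NAME; nothing restated. NOTHING here is a claim about Joshi's or Mochizuki's mathematics; no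
side is taken on [IUTchIII] Cor. 3.12 or on any author; a model exhibits satisfiability of TYPED hypotheses, nothing more.

## Census line this file closes (numbers, no verdict)

The named [J-IIp] §6 hypotheses of record over E-t3's typed signature — E-t2's `PeriodRingDatum.EtaPtTeich` (Lem. 6.10.1,
arXiv:2303.01662v3 p. 18 l. 11–15), E-t7's four inputs `PrimAnsatzGaloisStable` / `PrimAnsatzFrobeniusInvariant` (`↔` form, whose
`←`-half is the `ϕ^{−1}`-clause of Prop. 6.6.1, p. 16 l. 43–64) / `PrimAnsatzScaling` / `LStarThroughFrobenius`, together with a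
BIJECTIVE point-Frobenius and `p`-th roots in the tilt — are JOINTLY SATISFIABLE (`JointModel.joint`). Models of record before this
pair of files carried `EtaPtTeich` or a bijective `ϕ`, never both (E-t2's p437626 resp. this seat's p434861/p435471; separation
theorems p436434 `Joshi/PrimitiveAnsatzFrobeniusIndependence` and p439098 `ExpModel.not_etaPtTeich`). [folklore]
-/

noncomputable section

namespace Summit.ABC.IUTFork.Joshi.JointModel

variable (p : ℕ) [hp : Fact p.Prime]

/-! ## 1. The point map separates parameters of equal absolute value -/

/-- The joint model's point map DOES separate parameters of equal absolute value (as `EtaPtTeich` requires, by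
`PeriodRingDatum.exists_absF_eq_and_pt_ne_of_etaPtTeich` of p439098): `[w·p] ≠ [p]` although `‖w·p‖ = ‖p‖`. [folklore] -/
theorem pt_separates : ‖w p * p‖ = ‖(p : PadicAlgCl p)‖ ∧ (prototypeDatum p).pt (w p * p) ≠ (prototypeDatum p).pt p := by
  refine ⟨by rw [norm_mul, norm_w, one_mul], fun h => ?_⟩
  have hp0 : (p : PadicAlgCl p) ≠ 0 := by exact_mod_cast hp.out.ne_zero
  have h' : Rel p (p : PadicAlgCl p) ((p : PadicAlgCl p) * w p ^ 1) := by
    rw [pow_one, mul_comm]; exact rel_symm p ((mk_eq_mk_iff p).1 h)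
  exact not_rel_mul_w_pow p hp0 one_ne_zero h'

/-! ## 2. E-t7's four inputs at the glued adelic curve datum (this seat's certificate `PrototypeFamily`, p432358) -/

/-- The one-member prototype family of the joint model (index/place set `Unit`, one residue characteristic); its two binders are
`frobY_bijective` and `exists_pth_root` of part 1. [folklore] -/
def prototypeFamily : PrototypeFamily Unit (fun _ => PadicAlgCl p) (fun _ => Pt p → PadicAlgCl p) (fun _ => PadicAlgCl p)
    (fun _ => Pt p) (fun _ _ => PadicAlgCl p) (fun _ => Unit) where
  proto _ := prototypeDatum p
  lstar := 2
  one_le_lstar := by norm_num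
  lstar_eq _ := rfl
  frobY_bijective _ := frobY_bijective p
  perfect _ := exists_pth_root p

/-- **The adelic curve datum of the joint model** (E-t7's [J-III] §4.1–4.2 signature at the «local = global» datum: one place,
declared bad; `L′* := Unit`). [folklore] -/
abbrev adelicCurveDatum : AdelicCurveDatum := (prototypeFamily p).toAdelicCurveDatum Set.univ

/-- Its gluing certificate (p432358 §4). [folklore] -/
def supply : (adelicCurveDatum p).PrototypeSupply (fun _ => PadicAlgCl p) (fun _ => Pt p → PadicAlgCl p) (fun _ => PadicAlgCl p)
    (fun _ _ => PadicAlgCl p) :=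
  (prototypeFamily p).supply Set.univ

/-- At the «local = global» datum `L′* = Unit` acts through `ϕ^0`. [folklore] -/
theorem lStarThroughFrobenius : (adelicCurveDatum p).LStarThroughFrobenius :=
  fun _ _ _ => ⟨0, fun _ => by simp; rfl⟩

/-- **E-t7's four inputs hold at the joint model's adelic curve datum** — in particular `PrimAnsatzFrobeniusInvariant` in its `↔`
form, whose `←`-half (the `ϕ^{−1}`-clause of [J-IIp] Prop. 6.6.1) is FALSE in the O1 models (p436434). [folklore] -/
theorem inputs :
    (adelicCurveDatum p).PrimAnsatzGaloisStable ∧ (adelicCurveDatum p).PrimAnsatzFrobeniusInvariant ∧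
      (adelicCurveDatum p).PrimAnsatzScaling ∧ (adelicCurveDatum p).LStarThroughFrobenius :=
  ⟨(supply p).primAnsatzGaloisStable, (supply p).primAnsatzFrobeniusInvariant, (supply p).primAnsatzScaling,
    lStarThroughFrobenius p⟩

/-- Hence [J-III] Thm. 4.2.2.1 (1), (2), (3) (diagonal reading), (4), (5) all hold at the datum (E-t7's `_of` theorems through the
certificate, as in p435471). [claim: Joshi2024ATS3, status: disputed] -/
theorem thm4221 :
    (adelicCurveDatum p).AnsatzGaloisStable ∧ (adelicCurveDatum p).AnsatzFrobeniusStable ∧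
      (adelicCurveDatum p).AnsatzLStarStableDiag ∧ (adelicCurveDatum p).ValuationScaling ∧
        (adelicCurveDatum p).ValuationConstantOffSS :=
  ⟨(supply p).ansatzGaloisStable, (supply p).ansatzFrobeniusStable,
    (supply p).ansatzLStarStableDiag (lStarThroughFrobenius p), (supply p).valuationScaling,
    (adelicCurveDatum p).valuationConstantOffSS_holds⟩

/-! ## 3. Packaged -/

/-- **JOINT SATISFIABILITY (a model exhibits satisfiability, nothing more).** At ONE datum over E-t3's typed [J-IIp] signature:
E-t2's `EtaPtTeich`, a bijective point-Frobenius with `p`-th roots in the tilt, and E-t7's four inputs (glued along this seat's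
`PrototypeSupply`) hold together. [folklore] -/
theorem joint :
    (prototypeDatum p).EtaPtTeich ∧ Function.Bijective (prototypeDatum p).frobY ∧
      (∀ b : PadicAlgCl p, ∃ a, a ^ (prototypeDatum p).p = b) ∧
        (adelicCurveDatum p).PrimAnsatzGaloisStable ∧ (adelicCurveDatum p).PrimAnsatzFrobeniusInvariant ∧
          (adelicCurveDatum p).PrimAnsatzScaling ∧ (adelicCurveDatum p).LStarThroughFrobenius :=
  ⟨etaPtTeich p, frobY_bijective p, exists_pth_root p, inputs p⟩

/-- **Existential form** (the census sentence as one closed statement, instantiated at `p = 2`): there is an adelic curve datum at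
which E-t7's four inputs hold and whose local prototype — E-t3's `PrototypeDatum` over `Q̄_2` with points `Q̄_2/∼` — satisfies E-t2's
`EtaPtTeich` with a bijective point-Frobenius. [folklore] -/
theorem jointly_satisfiable :
    ∃ (D : AdelicCurveDatum) (P : PrototypeDatum (PadicAlgCl 2) (Pt 2 → PadicAlgCl 2) (PadicAlgCl 2) (Pt 2)
        (fun _ => PadicAlgCl 2) Unit),
      D.PrimAnsatzGaloisStable ∧ D.PrimAnsatzFrobeniusInvariant ∧ D.PrimAnsatzScaling ∧ D.LStarThroughFrobenius ∧
        P.EtaPtTeich ∧ Function.Bijective P.frobY ∧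
          Nonempty (D.PrototypeSupply (fun _ => PadicAlgCl 2) (fun _ => Pt 2 → PadicAlgCl 2) (fun _ => PadicAlgCl 2)
            (fun _ _ => PadicAlgCl 2)) :=
  haveI : Fact (Nat.Prime 2) := ⟨Nat.prime_two⟩
  ⟨adelicCurveDatum 2, prototypeDatum 2, (inputs 2).1, (inputs 2).2.1, (inputs 2).2.2.1, (inputs 2).2.2.2, etaPtTeich 2,
    frobY_bijective 2, ⟨supply 2⟩⟩

end Summit.ABC.IUTFork.Joshi.JointModel

end
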